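import Mathlib
import HarnessLib
import Summits.HubbardSuperconductivity.HubbardSuperconductivity.Theorems.KLProgrammeKLRegimeEngineFrameShiftResponseDoorCTMismatch
import Summits.HubbardSuperconductivity.HubbardSuperconductivity.Theorems.KLProgrammeKLRegimeSplitSlotsV17F
import Summits.HubbardSuperconductivity.HubbardSuperconductivity.Theorems.KLProgrammeKLRegimeFrameShellCount
import Summits.HubbardSuperconductivity.HubbardSuperconductivity.Theorems.KLProgrammeKLRegimeSplitFrameDist
import Summits.HubbardSuperconductivity.HubbardSuperconductivity.Theorems.KLProgrammeKLRegimeSplitGlue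

/-!
# K3 gen-8-FLOW (stmt 20437 `KLRegimeEngineV17F2`, stub (C), located risk «(C)-B-REP», design B-CT p2 g13): the corrected (B) door AT THE FLOW FRAMES
# `K_m → K_{m+1}` — shell counts discharged by `FrameOK` and the Matsubara count, the frame step by `frameDist`

Cell gate-hubbard-kl, seat p2 g13.  Instance of `…EngineFrameShiftResponseDoorCTMismatch.norm_iteratedFDeriv_klLocSelfEnergyRe_frame_sub_le` at `K₁ = K_m`,
`K₂ = K_{m+1}` (`klFlowFrameU`), scale `Λ_m = klScale klE0 m`: the level counts by `card_frameLevel_lt_le` (`FrameOK` of BOTH frames; `Λ_m ≤ klE0 < 3/80`),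
the frequency count by `card_filter_matsubaraFreq_le` (`≤ Λ_mβ/π + 3`), the pointwise mismatch by `abs_eval_sub_le_frameDist` (`frameDist K_{m+1} K_m ≤ fd ≤ Λ_m/4`;
the history gives `fd = R.Gfr 0·|U|·4^{−2m}`, `frameDist_klFlowFrameU_succ_le`, and `fd ≤ Λ_m/4` is `R.Gfr 0·|U| ≤ klE0/4`, `frameDist_klFlowFrameU_succ_le_rate`):

**`norm_iteratedFDeriv_klLocSelfEnergyRe_flowFrame_sub_le`** —
`‖Dʲ[evalM (symInterp L (klLocSelfEnergyRe[K_{m+1}, m] − klLocSelfEnergyRe[K_m, m] − (K_{m+1} ⊖ K_m)∘p))](q)‖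
 ≤ 2·(2|β|L²·12·(2(Λ_mβ/π+3)·2(1793Λ_mL²+704L)·βL²(200+200B₁)fd/Λ_m²)·N) + (A+A′)/2 + A_J`
= the (B) part of (P) of c4a-1's `twoLegReadJetBound_succ_of_curveJetBound_of_prev` at scale `m+1` as MOMENTUM jets at a point `q` of the below-shell region
(to be composed with `γ_{K_{m+1}}` by the chain rule), modulo the ONE tower input `N` (four-leg pinned moments of `𝒲′[Ψ_{K_m}+t·d]` at the loop strings,
loop label on the scale-`m` shell), the tree jets `A, A′` and the dressing jets `A_J` (sup/aliasing route; zero data on the below-shell region) and the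
partition-function hypotheses.  LAW (≈): `N ≈ U/(4!(βL²)³)` ⇒ first term `≈ 2.3·10⁶(1+B₁)·U·fd ≤ 2.3·10⁶(1+B₁)Gfr₀·U²·16^{−m}` — m-free against
`curveJetBar · · U 0 (m+1) ∝ U·16^{−(m+1)}`.
Proofs only; nothing about `N`, `A`, `A′`, `A_J`, `Z` or the model's sizes is asserted; nothing asserts superconductivity.  References: BGM 2006 §2.3 (2.21)–(2.24),
§3 (3.3) [cite: BenfattoGiulianiMastropietro2006]; FST 1996 §1.
-/

noncomputable section

namespace Summit.HubbardSuperconductivity.HubbardSuperconductivity.Theorems.EngineV8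

set_option linter.dupNamespace false -- summit = problem name (single-conjunct summit), D-0017

open Finset Literature.MathematicalPhysics.QuantumLattice Literature.Probability.LatticeModels GrassmannAlgebra
open Summit.HubbardSuperconductivity.HubbardSuperconductivity.Theorems.KLRegimeSplit
open Summit.HubbardSuperconductivity.HubbardSuperconductivity.Theorems.TwoVolumeDefect
open Summit.HubbardSuperconductivity.HubbardSuperconductivity.Theorems.KLProgrammeLegKernels

variable {L M : ℕ} [NeZero L] [NeZero M]

section Flow

variable {β : ℝ} (hβ : 0 < β) (U μ : ℝ) (m : ℕ)
include hβ

/-- **THE CORRECTED (B) DOOR AT THE FLOW FRAMES `K_m → K_{m+1}`** (mismatch-resummed representation, jet form, shell counts discharged).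
[cite: BenfattoGiulianiMastropietro2006, §2.3 (2.21)–(2.24)] -/
theorem norm_iteratedFDeriv_klLocSelfEnergyRe_flowFrame_sub_le
    {R : RenConsts} {Nf₁ Nf₂ : ℕ} (hOK₁ : FrameOK R U Nf₁ μ (klFlowFrameU L M β U μ m)) (hOK₂ : FrameOK R U Nf₂ μ (klFlowFrameU L M β U μ (m + 1)))
    {B₁ : ℝ} (hB0 : 0 ≤ B₁) (hB : ∀ y, |deriv salmhoferCutoff y| ≤ B₁)
    {fd : ℝ} (hfdist : frameDist (klFlowFrameU L M β U μ (m + 1)) (klFlowFrameU L M β U μ m) ≤ fd) (hfd : fd ≤ klScale klE0 m / 4)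
    (hZ₂ : IsUnit (effPartitionFn ℂ (normalCovariance L M (uvSymbolCT L M β μ (klFlowFrameU L M β U μ (m + 1)) (klScale klE0 m)))
      (hubbardInteraction L M β U + counterQuadratic L M β (klFlowFrameU L M β U μ (m + 1)))))
    (hZ : ∀ t ∈ Set.Icc (0 : ℝ) 1, effPartitionFn ℂ
      (normalCovariance L M (uvSymbolCT L M β μ (klFlowFrameU L M β U μ m) (klScale klE0 m)) + ((t : ℂ)) •
        (normalCovariance L M (fun ks => uvSymbolCT L M β μ (klFlowFrameU L M β U μ (m + 1)) (klScale klE0 m) ks /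
            (1 + uvSymbolCT L M β μ (klFlowFrameU L M β U μ (m + 1)) (klScale klE0 m) ks * (((fsub (klFlowFrameU L M β U μ (m + 1)) (klFlowFrameU L M β U μ m)).eval (latticeMomentum L ks.1.2) / (β * (L : ℝ) ^ 2) : ℝ) : ℂ))) -
          normalCovariance L M (uvSymbolCT L M β μ (klFlowFrameU L M β U μ m) (klScale klE0 m))))
      (hubbardInteraction L M β U + counterQuadratic L M β (klFlowFrameU L M β U μ m)) ≠ 0)
    (j : ℕ) (q : Momentum) {N A A' AJ : ℝ} (hN0 : 0 ≤ N) (hA0 : 0 ≤ A) (hA0' : 0 ≤ A')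
    (hN : ∀ t ∈ Set.Icc (0 : ℝ) 1, ∀ i ∈ ({omega0 M, (omega0 M).rev} : Finset (MatsubaraIdx M)), ∀ σ : Fin 2, ∀ Al : HubbardFieldIdx L M,
      |matsubaraFreq β M Al.1.1.1| < klScale klE0 m →
      (|nambuXiCT L μ (klFlowFrameU L M β U μ m) Al.1.1.2| < klScale klE0 m ∨ |nambuXiCT L μ (klFlowFrameU L M β U μ (m + 1)) Al.1.1.2| < klScale klE0 m) →
      ∑ x : TorusSite 2 L, (1 + ((x 0).valMinAbs.natAbs : ℝ) + ((x 1).valMinAbs.natAbs : ℝ)) ^ j * ‖torusFourierInv (fun kv : TorusSite 2 L =>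
        kernel ℂ (effAction ℂ (normalCovariance L M (uvSymbolCT L M β μ (klFlowFrameU L M β U μ m) (klScale klE0 m)) + ((t : ℂ)) •
          (normalCovariance L M (fun ks => uvSymbolCT L M β μ (klFlowFrameU L M β U μ (m + 1)) (klScale klE0 m) ks /
              (1 + uvSymbolCT L M β μ (klFlowFrameU L M β U μ (m + 1)) (klScale klE0 m) ks * (((fsub (klFlowFrameU L M β U μ (m + 1)) (klFlowFrameU L M β U μ m)).eval (latticeMomentum L ks.1.2) / (β * (L : ℝ) ^ 2) : ℝ) : ℂ))) -
            normalCovariance L M (uvSymbolCT L M β μ (klFlowFrameU L M β U μ m) (klScale klE0 m))))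
          (hubbardInteraction L M β U + counterQuadratic L M β (klFlowFrameU L M β U μ m))) 4
          (Fin.snoc (Fin.snoc ![((((i, kv), σ), 0) : HubbardFieldIdx L M), (((i, kv), σ), 1)] (Al.1, 1 - Al.2) : Fin 3 → HubbardFieldIdx L M) Al)) x‖ ≤ N)
    (hT : ∀ t ∈ Set.Icc (0 : ℝ) 1,
      ‖iteratedFDeriv ℝ j (evalM (symInterp L (fun kv : TorusSite 2 L => ((∑ σ : Fin 2,
        (selfEnergy L M β (grassmannDerivPairing ℂ
            (normalCovariance L M (fun ks => uvSymbolCT L M β μ (klFlowFrameU L M β U μ (m + 1)) (klScale klE0 m) ks /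
                (1 + uvSymbolCT L M β μ (klFlowFrameU L M β U μ (m + 1)) (klScale klE0 m) ks * (((fsub (klFlowFrameU L M β U μ (m + 1)) (klFlowFrameU L M β U μ m)).eval (latticeMomentum L ks.1.2) / (β * (L : ℝ) ^ 2) : ℝ) : ℂ))) -
              normalCovariance L M (uvSymbolCT L M β μ (klFlowFrameU L M β U μ m) (klScale klE0 m)))
            (effAction ℂ (normalCovariance L M (uvSymbolCT L M β μ (klFlowFrameU L M β U μ m) (klScale klE0 m)) + ((t : ℂ)) •
              (normalCovariance L M (fun ks => uvSymbolCT L M β μ (klFlowFrameU L M β U μ (m + 1)) (klScale klE0 m) ks /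
                  (1 + uvSymbolCT L M β μ (klFlowFrameU L M β U μ (m + 1)) (klScale klE0 m) ks * (((fsub (klFlowFrameU L M β U μ (m + 1)) (klFlowFrameU L M β U μ m)).eval (latticeMomentum L ks.1.2) / (β * (L : ℝ) ^ 2) : ℝ) : ℂ))) -
                normalCovariance L M (uvSymbolCT L M β μ (klFlowFrameU L M β U μ m) (klScale klE0 m))))
              (hubbardInteraction L M β U + counterQuadratic L M β (klFlowFrameU L M β U μ m)))
            (effAction ℂ (normalCovariance L M (uvSymbolCT L M β μ (klFlowFrameU L M β U μ m) (klScale klE0 m)) + ((t : ℂ)) •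
              (normalCovariance L M (fun ks => uvSymbolCT L M β μ (klFlowFrameU L M β U μ (m + 1)) (klScale klE0 m) ks /
                  (1 + uvSymbolCT L M β μ (klFlowFrameU L M β U μ (m + 1)) (klScale klE0 m) ks * (((fsub (klFlowFrameU L M β U μ (m + 1)) (klFlowFrameU L M β U μ m)).eval (latticeMomentum L ks.1.2) / (β * (L : ℝ) ^ 2) : ℝ) : ℂ))) -
                normalCovariance L M (uvSymbolCT L M β μ (klFlowFrameU L M β U μ m) (klScale klE0 m))))
              (hubbardInteraction L M β U + counterQuadratic L M β (klFlowFrameU L M β U μ m)))) (omega0 M, kv) σ +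
          selfEnergy L M β (grassmannDerivPairing ℂ
            (normalCovariance L M (fun ks => uvSymbolCT L M β μ (klFlowFrameU L M β U μ (m + 1)) (klScale klE0 m) ks /
                (1 + uvSymbolCT L M β μ (klFlowFrameU L M β U μ (m + 1)) (klScale klE0 m) ks * (((fsub (klFlowFrameU L M β U μ (m + 1)) (klFlowFrameU L M β U μ m)).eval (latticeMomentum L ks.1.2) / (β * (L : ℝ) ^ 2) : ℝ) : ℂ))) -
              normalCovariance L M (uvSymbolCT L M β μ (klFlowFrameU L M β U μ m) (klScale klE0 m)))
            (effAction ℂ (normalCovariance L M (uvSymbolCT L M β μ (klFlowFrameU L M β U μ m) (klScale klE0 m)) + ((t : ℂ)) •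
              (normalCovariance L M (fun ks => uvSymbolCT L M β μ (klFlowFrameU L M β U μ (m + 1)) (klScale klE0 m) ks /
                  (1 + uvSymbolCT L M β μ (klFlowFrameU L M β U μ (m + 1)) (klScale klE0 m) ks * (((fsub (klFlowFrameU L M β U μ (m + 1)) (klFlowFrameU L M β U μ m)).eval (latticeMomentum L ks.1.2) / (β * (L : ℝ) ^ 2) : ℝ) : ℂ))) -
                normalCovariance L M (uvSymbolCT L M β μ (klFlowFrameU L M β U μ m) (klScale klE0 m))))
              (hubbardInteraction L M β U + counterQuadratic L M β (klFlowFrameU L M β U μ m)))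
            (effAction ℂ (normalCovariance L M (uvSymbolCT L M β μ (klFlowFrameU L M β U μ m) (klScale klE0 m)) + ((t : ℂ)) •
              (normalCovariance L M (fun ks => uvSymbolCT L M β μ (klFlowFrameU L M β U μ (m + 1)) (klScale klE0 m) ks /
                  (1 + uvSymbolCT L M β μ (klFlowFrameU L M β U μ (m + 1)) (klScale klE0 m) ks * (((fsub (klFlowFrameU L M β U μ (m + 1)) (klFlowFrameU L M β U μ m)).eval (latticeMomentum L ks.1.2) / (β * (L : ℝ) ^ 2) : ℝ) : ℂ))) -
                normalCovariance L M (uvSymbolCT L M β μ (klFlowFrameU L M β U μ m) (klScale klE0 m))))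
              (hubbardInteraction L M β U + counterQuadratic L M β (klFlowFrameU L M β U μ m)))) ((omega0 M).rev, kv) σ)) / 4).re))) q‖ ≤ A ∧
      ‖iteratedFDeriv ℝ j (evalM (symInterp L (fun kv : TorusSite 2 L => ((∑ σ : Fin 2,
        (selfEnergy L M β (grassmannDerivPairing ℂ
            (normalCovariance L M (fun ks => uvSymbolCT L M β μ (klFlowFrameU L M β U μ (m + 1)) (klScale klE0 m) ks /
                (1 + uvSymbolCT L M β μ (klFlowFrameU L M β U μ (m + 1)) (klScale klE0 m) ks * (((fsub (klFlowFrameU L M β U μ (m + 1)) (klFlowFrameU L M β U μ m)).eval (latticeMomentum L ks.1.2) / (β * (L : ℝ) ^ 2) : ℝ) : ℂ))) -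
              normalCovariance L M (uvSymbolCT L M β μ (klFlowFrameU L M β U μ m) (klScale klE0 m)))
            (effAction ℂ (normalCovariance L M (uvSymbolCT L M β μ (klFlowFrameU L M β U μ m) (klScale klE0 m)) + ((t : ℂ)) •
              (normalCovariance L M (fun ks => uvSymbolCT L M β μ (klFlowFrameU L M β U μ (m + 1)) (klScale klE0 m) ks /
                  (1 + uvSymbolCT L M β μ (klFlowFrameU L M β U μ (m + 1)) (klScale klE0 m) ks * (((fsub (klFlowFrameU L M β U μ (m + 1)) (klFlowFrameU L M β U μ m)).eval (latticeMomentum L ks.1.2) / (β * (L : ℝ) ^ 2) : ℝ) : ℂ))) -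
                normalCovariance L M (uvSymbolCT L M β μ (klFlowFrameU L M β U μ m) (klScale klE0 m))))
              (hubbardInteraction L M β U + counterQuadratic L M β (klFlowFrameU L M β U μ m)))
            (effAction ℂ (normalCovariance L M (uvSymbolCT L M β μ (klFlowFrameU L M β U μ m) (klScale klE0 m)) + ((t : ℂ)) •
              (normalCovariance L M (fun ks => uvSymbolCT L M β μ (klFlowFrameU L M β U μ (m + 1)) (klScale klE0 m) ks /
                  (1 + uvSymbolCT L M β μ (klFlowFrameU L M β U μ (m + 1)) (klScale klE0 m) ks * (((fsub (klFlowFrameU L M β U μ (m + 1)) (klFlowFrameU L M β U μ m)).eval (latticeMomentum L ks.1.2) / (β * (L : ℝ) ^ 2) : ℝ) : ℂ))) -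
                normalCovariance L M (uvSymbolCT L M β μ (klFlowFrameU L M β U μ m) (klScale klE0 m))))
              (hubbardInteraction L M β U + counterQuadratic L M β (klFlowFrameU L M β U μ m)))) (omega0 M, kv) σ +
          selfEnergy L M β (grassmannDerivPairing ℂ
            (normalCovariance L M (fun ks => uvSymbolCT L M β μ (klFlowFrameU L M β U μ (m + 1)) (klScale klE0 m) ks /
                (1 + uvSymbolCT L M β μ (klFlowFrameU L M β U μ (m + 1)) (klScale klE0 m) ks * (((fsub (klFlowFrameU L M β U μ (m + 1)) (klFlowFrameU L M β U μ m)).eval (latticeMomentum L ks.1.2) / (β * (L : ℝ) ^ 2) : ℝ) : ℂ))) -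
              normalCovariance L M (uvSymbolCT L M β μ (klFlowFrameU L M β U μ m) (klScale klE0 m)))
            (effAction ℂ (normalCovariance L M (uvSymbolCT L M β μ (klFlowFrameU L M β U μ m) (klScale klE0 m)) + ((t : ℂ)) •
              (normalCovariance L M (fun ks => uvSymbolCT L M β μ (klFlowFrameU L M β U μ (m + 1)) (klScale klE0 m) ks /
                  (1 + uvSymbolCT L M β μ (klFlowFrameU L M β U μ (m + 1)) (klScale klE0 m) ks * (((fsub (klFlowFrameU L M β U μ (m + 1)) (klFlowFrameU L M β U μ m)).eval (latticeMomentum L ks.1.2) / (β * (L : ℝ) ^ 2) : ℝ) : ℂ))) -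
                normalCovariance L M (uvSymbolCT L M β μ (klFlowFrameU L M β U μ m) (klScale klE0 m))))
              (hubbardInteraction L M β U + counterQuadratic L M β (klFlowFrameU L M β U μ m)))
            (effAction ℂ (normalCovariance L M (uvSymbolCT L M β μ (klFlowFrameU L M β U μ m) (klScale klE0 m)) + ((t : ℂ)) •
              (normalCovariance L M (fun ks => uvSymbolCT L M β μ (klFlowFrameU L M β U μ (m + 1)) (klScale klE0 m) ks /
                  (1 + uvSymbolCT L M β μ (klFlowFrameU L M β U μ (m + 1)) (klScale klE0 m) ks * (((fsub (klFlowFrameU L M β U μ (m + 1)) (klFlowFrameU L M β U μ m)).eval (latticeMomentum L ks.1.2) / (β * (L : ℝ) ^ 2) : ℝ) : ℂ))) -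
                normalCovariance L M (uvSymbolCT L M β μ (klFlowFrameU L M β U μ m) (klScale klE0 m))))
              (hubbardInteraction L M β U + counterQuadratic L M β (klFlowFrameU L M β U μ m)))) ((omega0 M).rev, kv) σ)) / 4).im))) q‖ ≤ A')
    (hJ : ‖iteratedFDeriv ℝ j (evalM (symInterp L (fun kv : TorusSite 2 L =>
        (∑ σ : Fin 2, ∑ i ∈ ({omega0 M, (omega0 M).rev} : Finset (MatsubaraIdx M)),
          (-(((β * (L : ℝ) ^ 2 : ℝ) : ℂ) * (((fsub (klFlowFrameU L M β U μ (m + 1)) (klFlowFrameU L M β U μ m)).eval (latticeMomentum L kv) / (β * (L : ℝ) ^ 2) : ℝ) : ℂ) ^ 2 *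
              (uvSymbolCT L M β μ (klFlowFrameU L M β U μ (m + 1)) (klScale klE0 m) ((i, kv), σ) /
                (1 + uvSymbolCT L M β μ (klFlowFrameU L M β U μ (m + 1)) (klScale klE0 m) ((i, kv), σ) * (((fsub (klFlowFrameU L M β U μ (m + 1)) (klFlowFrameU L M β U μ m)).eval (latticeMomentum L kv) / (β * (L : ℝ) ^ 2) : ℝ) : ℂ)))) +
            ((1 - (((fsub (klFlowFrameU L M β U μ (m + 1)) (klFlowFrameU L M β U μ m)).eval (latticeMomentum L kv) / (β * (L : ℝ) ^ 2) : ℝ) : ℂ) *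
                (uvSymbolCT L M β μ (klFlowFrameU L M β U μ (m + 1)) (klScale klE0 m) ((i, kv), σ) /
                  (1 + uvSymbolCT L M β μ (klFlowFrameU L M β U μ (m + 1)) (klScale klE0 m) ((i, kv), σ) * (((fsub (klFlowFrameU L M β U μ (m + 1)) (klFlowFrameU L M β U μ m)).eval (latticeMomentum L kv) / (β * (L : ℝ) ^ 2) : ℝ) : ℂ)))) ^ 2 -
                1) *
              selfEnergy L M β (effAction ℂ (normalCovariance L M fun ks =>
                uvSymbolCT L M β μ (klFlowFrameU L M β U μ (m + 1)) (klScale klE0 m) ks /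
                  (1 + uvSymbolCT L M β μ (klFlowFrameU L M β U μ (m + 1)) (klScale klE0 m) ks * (((fsub (klFlowFrameU L M β U μ (m + 1)) (klFlowFrameU L M β U μ m)).eval (latticeMomentum L ks.1.2) / (β * (L : ℝ) ^ 2) : ℝ) : ℂ)))
              (hubbardInteraction L M β U + counterQuadratic L M β (klFlowFrameU L M β U μ m))) (i, kv) σ).re) / 4))) q‖ ≤ AJ) :
    ‖iteratedFDeriv ℝ j (evalM (symInterp L (fun kv : TorusSite 2 L =>
        klLocSelfEnergyRe L M β U μ (klFlowFrameU L M β U μ (m + 1)) m kv - klLocSelfEnergyRe L M β U μ (klFlowFrameU L M β U μ m) m kv - (fsub (klFlowFrameU L M β U μ (m + 1)) (klFlowFrameU L M β U μ m)).eval (latticeMomentum L kv)))) q‖ ≤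
      2 * (2 * (|β| * (L : ℝ) ^ 2) * (12 * (2 * (klScale klE0 m * β / Real.pi + 3) *
        ((1793 * klScale klE0 m * (L : ℝ) ^ 2 + 704 * L) + (1793 * klScale klE0 m * (L : ℝ) ^ 2 + 704 * L)) *
        (β * (L : ℝ) ^ 2 * (200 + 200 * B₁) / klScale klE0 m ^ 2 * fd)) * N)) + (A + A') / 2 + AJ := by
  have hL : (0 : ℝ) < L := by exact_mod_cast NeZero.pos L
  have hΛ : 0 < klScale klE0 m := by unfold klScale; exact mul_pos klE0_pos (by positivity)
  have hΛle : klScale klE0 m ≤ 3 / 80 := by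
    have h1 : klScale klE0 m ≤ klE0 := by
      unfold klScale
      exact mul_le_of_le_one_right klE0_pos.le (inv_le_one_of_one_le₀ (one_le_pow₀ (by norm_num)))
    exact h1.trans (by norm_num [klE0])
  -- pointwise mismatch bound from the frame distance
  have hD : ∀ kv : TorusSite 2 L, |(fsub (klFlowFrameU L M β U μ (m + 1)) (klFlowFrameU L M β U μ m)).eval (latticeMomentum L kv)| ≤ fd :=
    fun kv => by rw [eval_fsub]; exact (abs_eval_sub_le_frameDist _ _ _).trans hfdist
  -- the counts
  set Nω := (Finset.univ.filter fun i : MatsubaraIdx M => |matsubaraFreq β M i| < klScale klE0 m).card with hNω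
  set Nk₁ := (Finset.univ.filter fun kv : TorusSite 2 L => |nambuXiCT L μ (klFlowFrameU L M β U μ m) kv| < klScale klE0 m).card with hNk₁
  set Nk₂ := (Finset.univ.filter fun kv : TorusSite 2 L => |nambuXiCT L μ (klFlowFrameU L M β U μ (m + 1)) kv| < klScale klE0 m).card with hNk₂
  have hω : (Nω : ℝ) ≤ klScale klE0 m * β / Real.pi + 3 :=
    card_filter_matsubaraFreq_le hβ hΛ.le _ fun i hi => ((Finset.mem_filter.1 hi).2).le
  have hk₁ : (Nk₁ : ℝ) ≤ 1793 * klScale klE0 m * (L : ℝ) ^ 2 + 704 * L := card_frameLevel_lt_le hOK₁ hΛ hΛle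
  have hk₂ : (Nk₂ : ℝ) ≤ 1793 * klScale klE0 m * (L : ℝ) ^ 2 + 704 * L := card_frameLevel_lt_le hOK₂ hΛ hΛle
  have hdoor := norm_iteratedFDeriv_klLocSelfEnergyRe_frame_sub_le hβ U μ (klFlowFrameU L M β U μ m) (klFlowFrameU L M β U μ (m + 1)) m
    hB0 hB hΛ hfd hD le_rfl le_rfl le_rfl hZ₂ hZ j q hN0 hA0 hA0' hN hT hJ
  refine hdoor.trans ?_
  have hfd0 : 0 ≤ fd := (frameDist_nonneg _ _).trans hfdist
  gcongr

end Flow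

end Summit.HubbardSuperconductivity.HubbardSuperconductivity.Theorems.EngineV8

end
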